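import Literature.NumberTheory.Transcendental.AyoubPeriodSeries
import Mathlib.Analysis.Normed.Ring.InfiniteSum
import Mathlib.Analysis.Complex.Basic
import Mathlib.Data.Finsupp.Order

/-!
# Ayoub's analytic relative Kontsevich–Zagier theorem — the generators integrate to `0`

Proofs only (no new definitions, no new facts; sibling of `AyoubPeriodSeriesProofs.lean`, which
treats the finite-`ϖ`-support case of Théorème 1.11), on top of
`Literature/NumberTheory/Transcendental/AyoubPeriodSeries.lean`, which defines the objects of
J. Ayoub, *La version relative de la conjecture des périodes de Kontsevich–Zagier revisitée*
(note, Univ. Zürich = Tohoku Math. J. (2) 71 (2019) 465–485; `AyoubRelKZRevisited`), §1.1: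
`Oan σ = 𝒪_{k-alg}(𝔻̄^∞)`, `intC = ∫_{[0,1]^∞}` (display (1)), `OanDagger σ = 𝒪†_{k-alg}(𝔻̄^∞)`,
`intCLaurent` (term-by-term integration, display (2)), the type (a) operator
`relAC i = ∂/∂zᵢ - (·)|_{zᵢ=1} + (·)|_{zᵢ=0}` (`pdz`, `restrC`), the generator sets `anGenA σ`,
`anGenB σ`, `anGenerators σ` of Théorème 1.1 and the `k`-span `kSpan σ`; and the NAMED FACTS
`ayoub_generators_le_kernel` (§1.3, display (6): the maps (6) are well defined, i.e.
`⟨(a), (b)⟩_k ⊆ ker (2)`) and `ayoub_integration_injective_localized` (Théorème 1.11).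

## What is proved here

* `ayoub_generators_le_kernel_holds` — DISCHARGES the fact `ayoub_generators_le_kernel`: for every
  field `k` of characteristic `0` and every `σ : k →+* ℂ`, term-by-term integration kills the
  `k`-span of the generators (a), (b). This is the inclusion `⊇` of Théorème 1.1 (and the
  well-definedness of the right-hand map (6) of §1.3); it needs no hypothesis on `π`.
* `ayoub_kernel_piAlgebraic_mpr` — the direction `⇐` of Théorème 1.1 (under `π` algebraic over
  `k`, `ker (2) = ⟨(a), (b)⟩_k`), unconditionally.

The direction `⇒` of Théorème 1.1 (`ker ⊆ span`) is the deep content of Ayoub's Annals paper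
(Ann. of Math. 181 (2015) Thm. 4.25 + erratum Remarque 1.3: motivic Galois group, Betti realisation,
rigid-analytic nearby motives, §2 of the note). It is derived from the named fact
`ayoub_integration_injective_localized` (Théorème 1.11, which the note says "généralise le
Théorème 1.1") in the sibling `AyoubPeriodSeriesPiAlgebraic.lean`
(`ayoub_kernel_piAlgebraic_of_localized`): Théorème 1.1 is no longer a separate named fact.

## The elementary argument (not spelled out in the note, where (6) is stated to be induced)

Write `c_a` for the coefficients of `F ∈ ℂ[[z]]`, `w(a) = ∏_{j ∈ supp a} (aⱼ + 1)⁻¹ = ∫_{[0,1]^m} z^a`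
and `g(b) = c_b · w(b ∖ i)` (`b ∖ i` = `b` with the `i`-th exponent erased). If `Σ_a ‖c_a‖ < ∞`
(true on `𝒪_{k-alg}(𝔻̄^∞)`, polyradius `> 1`), then absolutely convergent reindexings give
`∫ ∂F/∂zᵢ = Σ_{bᵢ ≠ 0} g(b)` (`(aᵢ + 1) w(a) = w(a ∖ i)`, `b = a + eᵢ`),
`∫ F|_{zᵢ=1} = Σ_b g(b)` (`b = a + n eᵢ`, `aᵢ = 0`, Fubini) and `∫ F|_{zᵢ=0} = Σ_{bᵢ = 0} g(b)`,
whence `∫ (∂F/∂zᵢ - F|_{zᵢ=1} + F|_{zᵢ=0}) = 0`. For type (b): if `f`, `g` involve disjoint sets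
of variables then `w(a + b) = w(a) w(b)` whenever `c_a(f) c_b(g) ≠ 0`, so the Cauchy product gives
`∫ f g = (∫ f)(∫ g) = 0`; and `∫` is additive on absolutely convergent integrands.
-/

noncomputable section

open Finsupp MvPowerSeries

namespace Literature.NumberTheory.Transcendental.AyoubRel

/-! ### The weights `w(a) = ∫_{[0,1]^∞} z^a = ∏ⱼ (aⱼ + 1)⁻¹` -/

/-- `‖w(a)‖ ≤ 1`. [folklore] -/
theorem norm_intWeight_le_one (a : ℕ →₀ ℕ) :
    ‖∏ j ∈ a.support, ((a j : ℂ) + 1)⁻¹‖ ≤ 1 := by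
  rw [norm_prod]
  refine Finset.prod_le_one (fun j _ => norm_nonneg _) fun j _ => ?_
  rw [norm_inv, show ((a j : ℂ) + 1) = ((a j + 1 : ℕ) : ℂ) by push_cast; ring,
    Complex.norm_natCast]
  exact inv_le_one_of_one_le₀ (by exact_mod_cast Nat.succ_le_succ (Nat.zero_le _))

/-- `(aᵢ + 1) · w(a) = w(a ∖ i)`. [folklore] -/
theorem succ_mul_intWeight (a : ℕ →₀ ℕ) (i : ℕ) :
    ((a i : ℂ) + 1) * ∏ j ∈ a.support, ((a j : ℂ) + 1)⁻¹ =
      ∏ j ∈ (a.erase i).support, (((a.erase i) j : ℂ) + 1)⁻¹ := by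
  classical
  by_cases h : a i = 0
  · have hi : i ∉ a.support := by simpa using h
    rw [erase_of_notMem_support hi, h, Nat.cast_zero, zero_add, one_mul]
  · have hi : i ∈ a.support := by simpa using h
    rw [← Finset.mul_prod_erase _ _ hi, ← mul_assoc,
      mul_inv_cancel₀ (Nat.cast_add_one_ne_zero (a i)), one_mul, support_erase]
    refine Finset.prod_congr rfl fun j hj => ?_
    rw [erase_ne (Finset.ne_of_mem_erase hj)]

/-- `w(a + b) = w(a) · w(b)` for monomials in disjoint sets of variables. [folklore] -/
theorem intWeight_add_of_disjoint (a b : ℕ →₀ ℕ) (h : Disjoint a.support b.support) :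
    ∏ j ∈ (a + b).support, (((a + b) j : ℂ) + 1)⁻¹ =
      (∏ j ∈ a.support, ((a j : ℂ) + 1)⁻¹) * ∏ j ∈ b.support, ((b j : ℂ) + 1)⁻¹ := by
  classical
  rw [support_add_eq h, Finset.prod_union h]
  congr 1
  · refine Finset.prod_congr rfl fun j hj => ?_
    have hb : b j = 0 := notMem_support_iff.mp (Finset.disjoint_left.mp h hj)
    rw [Finsupp.add_apply, hb, add_zero]
  · refine Finset.prod_congr rfl fun j hj => ?_
    have ha : a j = 0 := notMem_support_iff.mp (Finset.disjoint_right.mp h hj)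
    rw [Finsupp.add_apply, ha, zero_add]

/-- `(a + n eᵢ) ∖ i = a ∖ i`. [folklore] -/
theorem erase_add_single_self (a : ℕ →₀ ℕ) (i n : ℕ) :
    (a + single i n).erase i = a.erase i := by
  rw [erase_add, erase_single, add_zero]

/-! ### Absolute convergence on `𝒪_{k-alg}(𝔻̄^∞)` -/

/-- A series of polyradius of convergence `> 1` has absolutely summable coefficients
(`r^{|a|} ≥ 1`). [folklore] -/
theorem summable_norm_coeff_of_hasPolyradiusGtOne {F : CSeries} (h : HasPolyradiusGtOne F) :
    Summable fun a : ℕ →₀ ℕ => ‖coeff a F‖ := by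
  obtain ⟨r, hr, hs⟩ := h
  exact Summable.of_nonneg_of_le (fun a => norm_nonneg _)
    (fun a => le_mul_of_one_le_right (norm_nonneg _) (one_le_pow₀ hr.le)) hs

section Kernel

variable {k : Type} [Field k] (σ : k →+* ℂ)

/-- Coefficients of elements of `𝒪_{k-alg}(𝔻̄^∞)` are absolutely summable. [folklore] -/
theorem summable_norm_coeff_of_mem_Oan {F : CSeries} (h : F ∈ Oan σ) :
    Summable fun a : ℕ →₀ ℕ => ‖coeff a F‖ := summable_norm_coeff_of_hasPolyradiusGtOne h.2.1

end Kernel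

/-- The integrand of `∫ F` is summable when the coefficients are absolutely summable
(`‖w(a)‖ ≤ 1`). [folklore] -/
theorem summable_intC_integrand {F : CSeries} (hF : Summable fun a : ℕ →₀ ℕ => ‖coeff a F‖) :
    Summable fun a : ℕ →₀ ℕ => coeff a F * ∏ j ∈ a.support, ((a j : ℂ) + 1)⁻¹ :=
  Summable.of_norm_bounded hF fun a => by
    rw [norm_mul]
    exact mul_le_of_le_one_right (norm_nonneg _) (norm_intWeight_le_one a)

/-! ### Type (a): `∫ (∂F/∂zᵢ - F|_{zᵢ=1} + F|_{zᵢ=0}) = 0` -/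

section TypeA

variable {F : CSeries} (hF : Summable fun a : ℕ →₀ ℕ => ‖coeff a F‖) (i : ℕ)
include hF

/-- The auxiliary family `g(b) = c_b · w(b ∖ i)` is absolutely summable. [folklore] -/
theorem summable_norm_gAux :
    Summable fun b : ℕ →₀ ℕ =>
      ‖coeff b F * ∏ j ∈ (b.erase i).support, (((b.erase i) j : ℂ) + 1)⁻¹‖ :=
  Summable.of_nonneg_of_le (fun b => norm_nonneg _) (fun b => by
    rw [norm_mul]
    exact mul_le_of_le_one_right (norm_nonneg _) (norm_intWeight_le_one _)) hF

/-- `∫ ∂F/∂zᵢ = Σ_{bᵢ ≠ 0} c_b w(b ∖ i)`, as a `HasSum` statement for the integrand of `∫`.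
[folklore] -/
theorem hasSum_intC_pdz :
    HasSum (fun a : ℕ →₀ ℕ => coeff a (pdz i F) * ∏ j ∈ a.support, ((a j : ℂ) + 1)⁻¹)
      (∑' b : ℕ →₀ ℕ, if b i = 0 then 0 else
        coeff b F * ∏ j ∈ (b.erase i).support, (((b.erase i) j : ℂ) + 1)⁻¹) := by
  set G : (ℕ →₀ ℕ) → ℂ := fun b => if b i = 0 then 0 else
    coeff b F * ∏ j ∈ (b.erase i).support, (((b.erase i) j : ℂ) + 1)⁻¹ with hG
  have hGs : Summable G := by
    refine Summable.of_norm_bounded (summable_norm_gAux hF i) fun b => ?_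
    simp only [hG]
    split_ifs
    · rw [norm_zero]; exact norm_nonneg _
    · exact le_rfl
  have hinj : Function.Injective fun a : ℕ →₀ ℕ => a + single i 1 := add_left_injective _
  -- the integrand of `∫ ∂F/∂zᵢ` is `G ∘ (· + eᵢ)`
  have hterm : (fun a : ℕ →₀ ℕ => coeff a (pdz i F) * ∏ j ∈ a.support, ((a j : ℂ) + 1)⁻¹) =
      fun a => G (a + single i 1) := by
    funext a
    have hne : (a + single i 1 : ℕ →₀ ℕ) i ≠ 0 := by simp
    simp only [hG, if_neg hne]
    change (((a i : ℂ) + 1) * coeff (a + single i 1) F) * _ = _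
    rw [mul_comm ((a i : ℂ) + 1), mul_assoc, succ_mul_intWeight, erase_add_single_self]
  have hsupp : Function.support G ⊆ Set.range fun a : ℕ →₀ ℕ => a + single i 1 := by
    intro b hb
    have hbi : b i ≠ 0 := by
      intro h0
      exact hb (by simp [hG, h0])
    refine ⟨b - single i 1, ?_⟩
    change b - single i 1 + single i 1 = b
    exact tsub_add_cancel_of_le (single_le_iff.mpr (Nat.one_le_iff_ne_zero.mpr hbi))
  rw [hterm, ← hinj.tsum_eq hsupp]
  exact (hGs.comp_injective hinj).hasSum

/-- `∫ F|_{zᵢ=0} = Σ_{bᵢ = 0} c_b w(b ∖ i)`. [folklore] -/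
theorem hasSum_intC_restrC_zero :
    HasSum (fun a : ℕ →₀ ℕ => coeff a (restrC i 0 F) * ∏ j ∈ a.support, ((a j : ℂ) + 1)⁻¹)
      (∑' b : ℕ →₀ ℕ, if b i = 0 then
        coeff b F * ∏ j ∈ (b.erase i).support, (((b.erase i) j : ℂ) + 1)⁻¹ else 0) := by
  have hterm : (fun a : ℕ →₀ ℕ => coeff a (restrC i 0 F) * ∏ j ∈ a.support, ((a j : ℂ) + 1)⁻¹) =
      fun b => if b i = 0 then
        coeff b F * ∏ j ∈ (b.erase i).support, (((b.erase i) j : ℂ) + 1)⁻¹ else 0 := by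
    funext a
    change (if a i = 0 then ∑' n : ℕ, coeff (a + single i n) F * (0 : ℂ) ^ n else 0) * _ = _
    split_ifs with h
    · have hi : i ∉ a.support := by simpa using h
      rw [erase_of_notMem_support hi, tsum_eq_single 0 (fun n hn => by simp [hn])]
      simp
    · rw [zero_mul]
  rw [hterm]
  refine (Summable.of_norm_bounded (summable_norm_gAux hF i) fun b => ?_).hasSum
  split_ifs
  · exact le_rfl
  · rw [norm_zero]; exact norm_nonneg _

/-- `∫ F|_{zᵢ=1} = Σ_b c_b w(b ∖ i)` (reindex `b = a + n eᵢ`, `aᵢ = 0`, and Fubini). [folklore] -/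
theorem hasSum_intC_restrC_one :
    HasSum (fun a : ℕ →₀ ℕ => coeff a (restrC i 1 F) * ∏ j ∈ a.support, ((a j : ℂ) + 1)⁻¹)
      (∑' b : ℕ →₀ ℕ,
        coeff b F * ∏ j ∈ (b.erase i).support, (((b.erase i) j : ℂ) + 1)⁻¹) := by
  set g : (ℕ →₀ ℕ) → ℂ := fun b =>
    coeff b F * ∏ j ∈ (b.erase i).support, (((b.erase i) j : ℂ) + 1)⁻¹ with hg
  set h : (ℕ →₀ ℕ) × ℕ → ℂ := fun p => if p.1 i = 0 then g (p.1 + single i p.2) else 0 with hh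
  set ψ : (ℕ →₀ ℕ) → (ℕ →₀ ℕ) × ℕ := fun b => (b.erase i, b i) with hψ
  have hψinj : Function.Injective ψ := by
    intro b b' e
    simp only [hψ, Prod.mk.injEq] at e
    rw [← erase_add_single i b, ← erase_add_single i b', e.1, e.2]
  have hψcomp : ∀ b, h (ψ b) = g b := by
    intro b
    simp only [hh, hψ, erase_same, if_true, erase_add_single]
  have hrange : ∀ p, p ∉ Set.range ψ → h p = 0 := by
    rintro ⟨a, n⟩ hp
    simp only [hh]
    split_ifs with ha
    · exact absurd ⟨a + single i n, by
        simp only [hψ, Prod.mk.injEq, erase_add_single_self, Finsupp.add_apply, single_eq_same,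
          ha, zero_add, and_true]
        exact erase_of_notMem_support (by simpa using ha)⟩ hp
    · rfl
  have hhs : Summable h := by
    refine (hψinj.summable_iff hrange).mp ?_
    have : h ∘ ψ = g := funext hψcomp
    rw [this]
    exact Summable.of_norm (summable_norm_gAux hF i)
  -- the integrand of `∫ F|_{zᵢ=1}` at `a` is `Σ_n h(a, n)`
  have hterm : (fun a : ℕ →₀ ℕ => coeff a (restrC i 1 F) * ∏ j ∈ a.support, ((a j : ℂ) + 1)⁻¹) =
      fun a => ∑' n : ℕ, h (a, n) := by
    funext a
    change (if a i = 0 then ∑' n : ℕ, coeff (a + single i n) F * (1 : ℂ) ^ n else 0) * _ = _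
    split_ifs with ha
    · rw [← tsum_mul_right]
      refine tsum_congr fun n => ?_
      have hi : i ∉ a.support := by simpa using ha
      simp only [hh, if_pos ha, hg, one_pow, mul_one, erase_add_single_self,
        erase_of_notMem_support hi]
    · simp [hh, ha]
  have hsum : ∑' p, h p = ∑' b, g b := by
    rw [← hψinj.tsum_eq fun p hp => ?_]
    · exact tsum_congr hψcomp
    · by_contra hp'
      exact hp (hrange p hp')
  rw [hterm, ← hsum, hhs.tsum_prod]
  exact hhs.prod.hasSum

/-- **Type (a) generators integrate to `0`**: `∫ (∂F/∂zᵢ - F|_{zᵢ=1} + F|_{zᵢ=0}) = 0` for every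
`F ∈ ℂ[[z]]` with absolutely summable coefficients, as a `HasSum` statement for the integrand.
[cite: AyoubRelKZRevisited, §1.3 (6)] -/
theorem hasSum_intC_relAC :
    HasSum (fun a : ℕ →₀ ℕ => coeff a (relAC i F) * ∏ j ∈ a.support, ((a j : ℂ) + 1)⁻¹) 0 := by
  have hA := hasSum_intC_pdz hF i
  have hB := hasSum_intC_restrC_one hF i
  have hC := hasSum_intC_restrC_zero hF i
  have hABC := (hA.sub hB).add hC
  have hval : ((∑' b : ℕ →₀ ℕ, if b i = 0 then 0 else
        coeff b F * ∏ j ∈ (b.erase i).support, (((b.erase i) j : ℂ) + 1)⁻¹) -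
      ∑' b : ℕ →₀ ℕ, coeff b F * ∏ j ∈ (b.erase i).support, (((b.erase i) j : ℂ) + 1)⁻¹) +
      ∑' b : ℕ →₀ ℕ, (if b i = 0 then
        coeff b F * ∏ j ∈ (b.erase i).support, (((b.erase i) j : ℂ) + 1)⁻¹ else 0) = 0 := by
    have h1 : Summable fun b : ℕ →₀ ℕ => if b i = 0 then 0 else
        coeff b F * ∏ j ∈ (b.erase i).support, (((b.erase i) j : ℂ) + 1)⁻¹ :=
      Summable.of_norm_bounded (summable_norm_gAux hF i) fun b => by
        split_ifs
        · rw [norm_zero]; exact norm_nonneg _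
        · exact le_rfl
    have h2 : Summable fun b : ℕ →₀ ℕ => if b i = 0 then
        coeff b F * ∏ j ∈ (b.erase i).support, (((b.erase i) j : ℂ) + 1)⁻¹ else 0 :=
      Summable.of_norm_bounded (summable_norm_gAux hF i) fun b => by
        split_ifs
        · exact le_rfl
        · rw [norm_zero]; exact norm_nonneg _
    rw [sub_add_eq_add_sub, ← h1.tsum_add h2, sub_eq_zero]
    refine tsum_congr fun b => ?_
    split_ifs <;> simp
  have hfun : (fun a : ℕ →₀ ℕ => coeff a (relAC i F) * ∏ j ∈ a.support, ((a j : ℂ) + 1)⁻¹) =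
      fun a => coeff a (pdz i F) * ∏ j ∈ a.support, ((a j : ℂ) + 1)⁻¹ -
        coeff a (restrC i 1 F) * ∏ j ∈ a.support, ((a j : ℂ) + 1)⁻¹ +
        coeff a (restrC i 0 F) * ∏ j ∈ a.support, ((a j : ℂ) + 1)⁻¹ := by
    funext a
    rw [relAC, map_add, map_sub]
    ring
  rw [hval] at hABC
  exact hfun ▸ hABC

/-- `∫ (∂F/∂zᵢ - F|_{zᵢ=1} + F|_{zᵢ=0}) = 0`. [cite: AyoubRelKZRevisited, §1.3 (6)] -/
theorem intC_relAC_eq_zero : intC (relAC i F) = 0 :=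
  (hasSum_intC_relAC hF i).tsum_eq

end TypeA

/-! ### Type (b): `∫ (f · g) = (∫ f) · (∫ g)` for disjoint variables -/

section TypeB

variable {f g : CSeries} (hf : Summable fun a : ℕ →₀ ℕ => ‖coeff a f‖)
  (hg : Summable fun a : ℕ →₀ ℕ => ‖coeff a g‖) (hdisj : ∀ i, ¬ (UsesVar f i ∧ UsesVar g i))
include hf hg hdisj

/-- **Fubini for disjoint variables**: if `f`, `g ∈ ℂ[[z]]` have absolutely summable coefficients
and involve disjoint sets of variables, the integrand of `∫ (f g)` sums to `(∫ f)(∫ g)` (Cauchy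
product over `ℕ →₀ ℕ` and `w(a + b) = w(a) w(b)` on disjoint supports). [folklore] -/
theorem hasSum_intC_mul_of_disjoint :
    HasSum (fun c : ℕ →₀ ℕ => coeff c (f * g) * ∏ j ∈ c.support, ((c j : ℂ) + 1)⁻¹)
      (intC f * intC g) := by
  set F' : (ℕ →₀ ℕ) → ℂ := fun a => coeff a f * ∏ j ∈ a.support, ((a j : ℂ) + 1)⁻¹ with hF'
  set G' : (ℕ →₀ ℕ) → ℂ := fun a => coeff a g * ∏ j ∈ a.support, ((a j : ℂ) + 1)⁻¹ with hG'
  have hF's : Summable fun a => ‖F' a‖ := Summable.of_nonneg_of_le (fun _ => norm_nonneg _)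
    (fun a => by
      rw [hF', norm_mul]
      exact mul_le_of_le_one_right (norm_nonneg _) (norm_intWeight_le_one a)) hf
  have hG's : Summable fun a => ‖G' a‖ := Summable.of_nonneg_of_le (fun _ => norm_nonneg _)
    (fun a => by
      rw [hG', norm_mul]
      exact mul_le_of_le_one_right (norm_nonneg _) (norm_intWeight_le_one a)) hg
  have hprod : Summable fun x : (ℕ →₀ ℕ) × (ℕ →₀ ℕ) => F' x.1 * G' x.2 :=
    summable_mul_of_summable_norm hF's hG's
  have hcauchy := hF's.of_norm.tsum_mul_tsum_eq_tsum_sum_antidiagonal hG's.of_norm hprod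
  -- termwise identification of the integrand of `∫ (f g)` with the Cauchy product family
  have hterm : (fun c : ℕ →₀ ℕ => coeff c (f * g) * ∏ j ∈ c.support, ((c j : ℂ) + 1)⁻¹) =
      fun c => ∑ p ∈ Finset.HasAntidiagonal.antidiagonal c, F' p.1 * G' p.2 := by
    funext c
    rw [coeff_mul, Finset.sum_mul]
    refine Finset.sum_congr rfl fun p hp => ?_
    rw [Finset.HasAntidiagonal.mem_antidiagonal] at hp
    by_cases h0 : coeff p.1 f = 0
    · simp [hF', h0]
    by_cases h1 : coeff p.2 g = 0
    · simp [hG', h1]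
    have hd : Disjoint p.1.support p.2.support := by
      rw [Finset.disjoint_left]
      intro j hj1 hj2
      exact hdisj j ⟨⟨p.1, Finsupp.mem_support_iff.mp hj1, h0⟩,
        ⟨p.2, Finsupp.mem_support_iff.mp hj2, h1⟩⟩
    rw [← hp, intWeight_add_of_disjoint _ _ hd, hF', hG']
    ring
  rw [hterm, intC, intC, hcauchy]
  exact (summable_sum_mul_antidiagonal_of_summable_mul hprod).hasSum

/-- `∫ (f g) = (∫ f)(∫ g)` for `f`, `g` in disjoint variables, absolutely summable. [folklore] -/
theorem intC_mul_of_disjoint : intC (f * g) = intC f * intC g :=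
  (hasSum_intC_mul_of_disjoint hf hg hdisj).tsum_eq

end TypeB

/-! ### The span of the generators lies in the kernel -/

section Kernel

variable {k : Type} [Field k] (σ : k →+* ℂ)

/-- Every generator of type (a) or (b), coefficientwise in `ϖ`, has integrand summing to `0`.
[cite: AyoubRelKZRevisited, §1.3 (6)] -/
theorem hasSum_intC_coeff_of_mem_anGenerators {s : LaurentSeries CSeries}
    (hs : s ∈ anGenerators σ) (r : ℤ) :
    HasSum (fun a : ℕ →₀ ℕ => coeff a (s.coeff r) * ∏ j ∈ a.support, ((a j : ℂ) + 1)⁻¹) 0 := by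
  rcases hs with ⟨G, hG, i, rfl⟩ | ⟨f, hf, hf0, L, hL, hdisj, rfl⟩
  · rw [HahnSeries.map_coeff]
    exact hasSum_intC_relAC (summable_norm_coeff_of_mem_Oan σ (hG.1 r)) i
  · rw [HahnSeries.coeff_smul, smul_eq_mul]
    have h := hasSum_intC_mul_of_disjoint (summable_norm_coeff_of_mem_Oan σ hf)
      (summable_norm_coeff_of_mem_Oan σ (hL.1 r)) (fun j hj => hdisj j ⟨hj.1, r, hj.2⟩)
    rwa [hf0, zero_mul] at h

/-- **The maps (6) are well defined** (Ayoub, revisited note, §1.3): term-by-term integration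
kills the `k`-span of the generators (a) `∂G/∂zᵢ - G|_{zᵢ=1} + G|_{zᵢ=0}` and (b) `f · L`
(`∫ f = 0`, disjoint variables) — the inclusion `⊇` of Théorème 1.1, for every complex embedding
and with no hypothesis on `π`. Discharges the named fact `ayoub_generators_le_kernel`.
[cite: AyoubRelKZRevisited, §1.3 (6)] -/
theorem ayoub_generators_le_kernel_holds : ayoub_generators_le_kernel := by
  intro k _ _ σ x hx
  obtain ⟨n, c, s, hs, rfl⟩ := hx
  ext r
  rw [coeff_intCLaurent, HahnSeries.coeff_zero, HahnSeries.coeff_sum]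
  have key : HasSum (fun a : ℕ →₀ ℕ =>
      coeff a (∑ j, (σ (c j) • s j).coeff r) * ∏ j ∈ a.support, ((a j : ℂ) + 1)⁻¹) 0 := by
    have h := hasSum_sum (s := Finset.univ) fun j _ =>
      (hasSum_intC_coeff_of_mem_anGenerators σ (hs j) r).mul_left (σ (c j))
    simp only [mul_zero, Finset.sum_const_zero] at h
    have e : (fun a : ℕ →₀ ℕ =>
        coeff a (∑ j, (σ (c j) • s j).coeff r) * ∏ j ∈ a.support, ((a j : ℂ) + 1)⁻¹) =
        fun a => ∑ j, σ (c j) *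
          (coeff a ((s j).coeff r) * ∏ j ∈ a.support, ((a j : ℂ) + 1)⁻¹) := by
      funext a
      rw [map_sum, Finset.sum_mul]
      refine Finset.sum_congr rfl fun j _ => ?_
      rw [HahnSeries.coeff_smul, coeff_smul]
      ring
    rw [e]
    exact h
  exact key.tsum_eq

/-- **Théorème 1.1, direction `⇐`** (unconditionally: no hypothesis on `π`, any `σ`): an element
of `𝒪†_{k-alg}(𝔻̄^∞)` in the `k`-span of the generators (a), (b) has term-by-term integral `0`.
[cite: AyoubRelKZRevisited, Théorème 1.1] -/
theorem ayoub_kernel_piAlgebraic_mpr (k : Type) [Field k] [CharZero k] (σ : k →+* ℂ)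
    (F : LaurentSeries CSeries) (hF : F ∈ kSpan σ (anGenerators σ)) : intCLaurent F = 0 :=
  ayoub_generators_le_kernel_holds k σ F hF

end Kernel

end Literature.NumberTheory.Transcendental.AyoubRel
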